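import Literature.MathematicalPhysics.QuantumFieldTheory.Balaban1983to89.Beta.RemainderResidue
import Summits.QuantumFields.YangMills.Theorems.BalabanUVNodesK1EndOfNodes13PWSOfPartialSums

/-!
# BalabanUVNodes ∕ K1⁷ — THE CRUX's β-SIDE IS K2⁷'s: `StabilityBAtRecordR13SepCoPH` BY NAME from K1⁷'s registered STUB 1, K2⁷'s TWO registered stub texts (`D1AtRecord13`,
# `D4AtSlopeOfD1Record13`) read at the rung-1 witness, and the ceiling letter — no sign, no asymptotic-freedom floor on this road

TRACK A (YM-PLAN §2d), node N24 (binder B2, COMPOSITE), WIDTH SEAT `pub-ymgap-dag-n24-w1` (director-ym №197 ∕ HUMAN RULING D-0149; plan g77 W-SEAT-START-LIST v2 §1 n24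
ITEM 1, fourth module).  Key of record: K1⁷ `StabilityBAtRecordR13SepCoPH` = stmt-QuantumFields-20542; `--supports` it AS A HELPER (count-neutral).  Companion of this seat's
`…K1EndOfNodes13PWSOfPartialSums` ((2.6) [III] and the END headline from BOUNDED-BELOW PARTIAL SUMS of β; the θ-keyed consequent `stabilityB_body_of_rung1At_of_partialSumsH_of_ceiling`).

WHAT THIS FILE ADDS: the partial-sum floor SUPPLIED BY NAME from the K2 letters.  (D1) = drift of the record's one-loop numbers `OneLoopDrift d A β⁰_θ` (`|Σ_{j<k} β⁰_j − d·k| ≤ A`,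
[Balaban1987RG1] (2.12)–(2.13) p.268, [Balaban1988RG2Cluster] Lemma 3); (D4) ∧ B4 = `Gaps.BetaContFromD4Chain.AtSlopeCont (split₁₃ θ) γ₀ s` (remainder `|β¹| ≤ s` on `]0, γ₀]^{k+1}` with
(C-pt)).  `s ≤ d` ⟹ `FlowStepRuns.BetaPartialSumsLowerH 2A γ₀ β_θ` (`Beta.RemainderResidue.betaPartialSumsLowerH_of_drift_windowedLower` ∘ `windowedLower_of_remainderConst` ∘
`remainderConst_of_atSlopeCont`) and N26 gives `BetaUpperH (d + 2A + s) γ₀ β_θ` from the same pair.  In plan's `K2Skeleton13SepCoPH` the two stubs pin `d = s = stepBal Nc Lc`, so the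
slope condition is `le_rfl`.
* §0 `endStatementBPrinted_window_of_isRecordOfRecord₁₃CSepCoPHS_of_nodes_of_partialSumsH` — the D-KEYED twin at any S-class record `(D, w)` (dag-n10-d's
  `IsRecordOfRecord₁₃CSepCoPHS`): nodes + `BetaPartialSumsLowerH M γ₀ D.βfun` + `BetaUpperH w.βup γ₀ D.βfun` ⊢ `B16.EndStatementBPrinted D.C` ∧ window.
* §1 ★★ `stabilityB_body_of_rung1At_of_drift_atSlopeCont_le` — the consequent at θ from a rung-1 datum + drift + `AtSlopeCont` (N26's hypotheses VERBATIM) + `s ≤ d` + ceiling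
  `d + 2A + s ≤ w.βup`.
* §2 ★★★ `stabilityB_body_of_rung1At_of_k2Pair_of_ceiling` — the consequent at θ from a rung-1 datum + K2⁷'s two stub BODIES read at θ ((D1)'s pinned residue `Gaps.D1Residue.Residue`,
  (D4)'s `AtSlopeCont` at slope `stepBal Nc Lc`) + the ceiling letter `BetaUpperH w.βup γ₀ β_θ` (kept separate: (D1)'s defect `A` is existential).
* §3 ★★★★ `stabilityBAtRecordR13SepCoPH_of_stub1_of_k2Stubs_of_ceiling_at_witness` (`N = 2`) — THE ROUTE DECL BY NAME from K1⁷'s STUB 1 text, K2⁷'s `D1AtRecord13` ∧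
  `D4AtSlopeOfD1Record13` texts (VERBATIM) and «at every rung-1 witness `∃ γ₁ > 0, BetaUpperH w.βup γ₁ β_θ`» — an ALTERNATIVE kernel-checked composition of K1⁷ whose β-side is
  K2⁷'s registered pair; NODE O's sign ∕ AF floor (T09.F) is NOT on this road; the ceiling ([Balaban1987RG1] §1 p.264 «uniformly bounded», read against the witness's `w.βup`) is the one
  K1-specific β letter left.

HONEST SCOPE ∕ A6.  Implications only; K1⁷ stub 1, K2⁷ stubs 1 ∧ 2 and the ceiling are DISPLAYED hypotheses inhabited at NO θ here («not exhibited», №167) — K2⁷'s stubs are OPEN (instance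
0∕1 in the tree).  Nothing of Bałaban asserted; K1⁷ ∕ K2⁷ NOT closed; N24 COMPOSITE — no discharge, no count claim (typed 28∕28 · discharged 5∕27 unmoved).  One finite 𝕋⁴ programme at
fixed ε, Bałaban AS PRINTED; R4 closes ONLY the conditional finite-𝕋⁴ rung `BalabanLadder.UV` — the YM mass gap (Clay) is NOT proved by any of this; nothing continuum ∕ ℝ⁴ ∕ OS.
Theorems only: no `def`, no `instance`, no `sorry`, standard axioms.
-/

noncomputable section

open scoped Matrix.Norms.L2Operator

namespace Summit.QuantumFields.YangMills.BalabanUVNodes.K1EndOfNodes13PWSOfK2Pair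

open Literature.MathematicalPhysics.QuantumFieldTheory.Balaban1983to89
open Literature.MathematicalPhysics.QuantumFieldTheory.Balaban1983to89.Node00
open DagBinding T4Continuum T4DatumAssembly FlowStepRuns
open FlowStep (HBeta BetaUpperH prefixOf box_mono mem_box)
open Literature.MathematicalPhysics.QuantumFieldTheory.Balaban1983to89.Beta.Drift (OneLoopDrift)
open Literature.MathematicalPhysics.QuantumFieldTheory.Balaban1983to89.Beta.RemainderResidue (betaPartialSumsLowerH_of_drift_windowedLower windowedLower_of_remainderConst)
open Literature.MathematicalPhysics.QuantumFieldTheory.Balaban1983to89.Beta.OneStepResolventKernel (JetData)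
open Literature.MathematicalPhysics.QuantumFieldTheory.Balaban1983to89.Beta.OneStepKernelFamily (TbalOf)
open Summit.QuantumFields.BalabanUV.Gaps.BetaContFromD4Chain (AtSlopeCont remainderConst_of_atSlopeCont)
open Summit.QuantumFields.BalabanUV.Gaps.D1Residue (Residue d1Drift_of_residue)
open Summit.QuantumFields.YangMills.Theorems.BalabanUVNodesN26AtRecord13BetaBoxOfDriftAtSlope (betaUpperH_betaOfRecord₁₃_of_drift_atSlopeCont)
open Summit.QuantumFields.YangMills.BalabanUVNodes.K1BetaWindow13SOfNodes13PWSOfBoxH (nodes_leavesP_reletter_of_le_all isRecordOfRecord₁₃CSepCoPHS_reletter_of_le)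
open Summit.QuantumFields.YangMills.BalabanUVNodes.K1EndOfNodes13PWSOfPartialSums
  (stabilityB_body_of_rung1At_of_partialSumsH_of_ceiling endStatementBPrinted_of_nodesP_alongRuns_partialSums upper_alongRun_of_betaUpperH partialSums_alongRun_of_betaPartialSumsLowerH)

/-! ## §0. The D-keyed twin of the companion's θ-keyed consequent, at any S-class record `(D, w)` (dag-n10-d's `IsRecordOfRecord₁₃CSepCoPHS`) -/

section DKeyed

variable {F : T4Family} {N : ℕ} [NeZero N]

/-- **(B) ∧ WINDOW AT ANY S-CLASS RECORD `(D, w)` FROM THE NODES, THE PARTIAL-SUM FLOOR AND THE CEILING ON `D.βfun`** — the D-keyed twin of the companion's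
`stabilityB_body_of_rung1At_of_partialSumsH_of_ceiling` (= dag-n10-d's `endStatementBPrinted_of_isRecordOfRecord₁₃CSepCoPHS_of_nodes` with its β-binder replaced by
`FlowStepRuns.BetaPartialSumsLowerH M γ₀ D.βfun` + `BetaUpperH w.βup γ₀ D.βfun` and its window letter freed): the road replayed — `M ≥ 0`, `c := 1 − (1+w.β₀)⁻²`, window shrunk to
`γ₁ := min (min w.γ γ₀) √(c∕(M+1))` (LANDED-1's re-lettering lemmas), guarded (0.20) leaf, run-wise letters by the companion's §3 at `RGMachineCore.curries`, END by the companion's §2,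
`w.C = D.C`, window by n24-a's `N24_window_of_betaUpperH`.  CONDITIONAL on the two letters; nothing of Bałaban asserted.
[cite: Balaban1989LargeFieldII, Thm 1 p.355 + p.391; Balaban1988Convergent, (2.6) p.255, Cor. 3 (2.50) p.264; Balaban1987RG1, Thm 2 p.259, §1 (1.22) p.264, (0.17)–(0.20) pp.255–256 (bookkeeping)] -/
theorem endStatementBPrinted_window_of_isRecordOfRecord₁₃CSepCoPHS_of_nodes_of_partialSumsH {D : FiniteEpsData F (SU N)} {w : WorldP}
    (hRS : IsRecordOfRecord₁₃CSepCoPHS F N D w) (hnodes : ∀ P : B12.RunParams, Nodes (leavesP w P)) {γ₀ M : ℝ} (hγ₀ : 0 < γ₀)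
    (hps : BetaPartialSumsLowerH M γ₀ D.βfun) (hhi : BetaUpperH w.βup γ₀ D.βfun) :
    B16.EndStatementBPrinted D.C ∧ ∃ γ₁ : ℝ, 0 < γ₁ ∧ ∀ γ : ℝ, 0 < γ → γ ≤ γ₁ → ∃ P : B12.RunParams, 1 ≤ P.K ∧ (D.C P).flow.InInterval γ P.K := by
  have hγw : 0 < w.γ := gamma_pos_of_isRecordOfRecord₁₃CSepCoPHS hRS
  have hC : w.C = D.C := construction_eq_of_isRecordOfRecord₁₃CSepCoPHS hRS
  refine ⟨?_, N24_window_of_betaUpperH D hγ₀ hhi⟩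
  obtain ⟨θ, h, hθ, hD, hC', hγ, hL, hup⟩ := hRS
  subst hD
  have hRS : IsRecordOfRecord₁₃CSepCoPHS F N (datumOfRecord₁₃SepCoPH F N θ h) w := ⟨θ, h, hθ, rfl, hC', hγ, hL, hup⟩
  -- M ≥ 0 from the empty sum along the constant history γ₀
  have hM : 0 ≤ M := by
    have h0 := hps (fun _ => γ₀) (fun _ => ⟨hγ₀, le_rfl⟩) 0 0 le_rfl
    simp only [Finset.Ico_self, Finset.sum_empty] at h0
    linarith
  set c : ℝ := 1 - ((1 + w.β₀) ^ 2)⁻¹ with hc_def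
  have hc : 0 < c := by
    have h1 : 1 < (1 + w.β₀) ^ 2 := by nlinarith [w.β₀_pos]
    have h2 : ((1 + w.β₀) ^ 2)⁻¹ < 1 := inv_lt_one_of_one_lt₀ h1
    rw [hc_def]; linarith
  set γM : ℝ := Real.sqrt (c / (M + 1)) with hγM_def
  have hγM : 0 < γM := Real.sqrt_pos.mpr (by positivity)
  set γ₁ : ℝ := min (min w.γ γ₀) γM with hγ₁_def
  have hγ₁ : 0 < γ₁ := lt_min (lt_min hγw hγ₀) hγM
  have hγ₁w : γ₁ ≤ w.γ := (min_le_left _ _).trans (min_le_left _ _)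
  have hγ₁₀ : γ₁ ≤ γ₀ := (min_le_left _ _).trans (min_le_right _ _)
  have hsmall : M * γ₁ ^ 2 ≤ c := by
    have h1 : γ₁ ^ 2 ≤ γM ^ 2 := pow_le_pow_left₀ hγ₁.le (min_le_right _ _) 2
    have h2 : γM ^ 2 = c / (M + 1) := by rw [hγM_def, Real.sq_sqrt (by positivity)]
    have h3 : M * (c / (M + 1)) ≤ c := by
      rw [mul_div_assoc', div_le_iff₀ (by positivity)]
      nlinarith [hc, hM]
    calc M * γ₁ ^ 2 ≤ M * γM ^ 2 := mul_le_mul_of_nonneg_left h1 hM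
      _ = M * (c / (M + 1)) := by rw [h2]
      _ ≤ c := h3
  have hRS' : IsRecordOfRecord₁₃CSepCoPHS F N (datumOfRecord₁₃SepCoPH F N θ h) { w with γ := γ₁, b := w.b, b_pos := w.b_pos } :=
    isRecordOfRecord₁₃CSepCoPHS_reletter_of_le hRS hγ₁ hγ₁w w.b_pos
  have hcur : CurriesHBeta (datumOfRecord₁₃SepCoPH F N θ h).C.toB12 (betaOfRecord₁₃ F N θ.toStage13Params) :=
    (coreOfRecord₁₃CoPH F N θ).curries (fun p k => densOfRecord₁₃ F N θ.toStage13Params p k)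
  have hps' : BetaPartialSumsLowerH M γ₀ (betaOfRecord₁₃ F N θ.toStage13Params) := hps
  have hhi' : BetaUpperH w.βup γ₀ (betaOfRecord₁₃ F N θ.toStage13Params) := hhi
  have hB : B16.EndStatementBPrinted ({ w with γ := γ₁, b := w.b, b_pos := w.b_pos } : WorldP).C := by
    refine endStatementBPrinted_of_nodesP_alongRuns_partialSums { w with γ := γ₁, b := w.b, b_pos := w.b_pos } hγ₁ (M := M)
      (nodes_leavesP_reletter_of_le_all w hγ₁w w.b_pos hnodes)
      (fun P hsc => rgFlow_of_smallCouplings_of_isRecordOfRecord₁₃CSepCoPHS hRS' P hsc) (fun P hsc => ?_) (fun P hsc => ?_) hsmall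
    · have hsc' : ((datumOfRecord₁₃SepCoPH F N θ h).C.toB12 P).flow.InInterval γ₁ P.K := by
        show ((datumOfRecord₁₃SepCoPH F N θ h).C P).flow.InInterval γ₁ P.K
        rw [← hC]; exact hsc
      show ∀ j, j < P.K → (w.C P).flow.β (j + 1) ((w.C P).flow.g j) ≤ w.βup
      rw [hC]
      exact upper_alongRun_of_betaUpperH (datumOfRecord₁₃SepCoPH F N θ h).C.toB12 _ hcur hγ₁₀ hhi' P hsc'
    · have hsc' : ((datumOfRecord₁₃SepCoPH F N θ h).C.toB12 P).flow.InInterval γ₁ P.K := by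
        show ((datumOfRecord₁₃SepCoPH F N θ h).C P).flow.InInterval γ₁ P.K
        rw [← hC]; exact hsc
      show ∀ m n, m ≤ n → n ≤ P.K → -M ≤ ∑ j ∈ Finset.Ico m n, (w.C P).flow.β (j + 1) ((w.C P).flow.g j)
      rw [hC]
      exact partialSums_alongRun_of_betaPartialSumsLowerH (datumOfRecord₁₃SepCoPH F N θ h).C.toB12 _ hcur hγ₁₀ hps' P hsc'
  have : ({ w with γ := γ₁, b := w.b, b_pos := w.b_pos } : WorldP).C = (datumOfRecord₁₃SepCoPH F N θ h).C := hC
  rw [← this]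
  exact hB

end DKeyed

/-! ## §1. ★★ The two letters BY NAME from the K2 pair at θ: drift + `AtSlopeCont`, slope condition `s ≤ d`, ceiling `d + 2A + s ≤ w.βup` -/

section Drift

variable {F : T4Family} {N : ℕ} [NeZero N]

/-- **★★ THE CRUX's CONSEQUENT AT θ FROM A RUNG-1 DATUM AND THE K2 PAIR's LETTERS AT θ — NO SIGN, NO AF FLOOR.**  (D1) drift `OneLoopDrift d A β⁰_θ` of the record's one-loop numbers
(`|Σ_{j<k} β⁰_j − d·k| ≤ A`) and the row-(D4) ∧ B4 residue `AtSlopeCont (split₁₃ θ) γ₀ s` (N26's ∕ K2⁷'s hypotheses VERBATIM; in K2⁷'s registered skeleton `d = s = stepBal Nc Lc`), the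
SLOPE CONDITION `s ≤ d` (the remainder's box bound does not exceed the one-loop slope — `le_rfl` on K2⁷'s road) and the ceiling `d + 2A + s ≤ w.βup`: partial sums `≥ −2A` by
`Beta.RemainderResidue.betaPartialSumsLowerH_of_drift_windowedLower` ∘ `windowedLower_of_remainderConst` ∘ `Gaps.BetaContFromD4Chain.remainderConst_of_atSlopeCont`, ceiling by N26's
`betaUpperH_betaOfRecord₁₃_of_drift_atSlopeCont`, then the companion's θ-keyed theorem.  CONDITIONAL on the K2 pair; nothing of Bałaban asserted; K1⁷ NOT closed.
[cite: Balaban1987RG1, Thm 2 p.259, §1 p.264, (2.12)–(2.14) p.268 and (5.10) p.293; Balaban1988RG2Cluster, Lemma 3 (2.38) p.20; Balaban1989LargeFieldII, Thm 1 p.355; Balaban1988Convergent, (2.6) p.255 (bookkeeping)] -/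
theorem stabilityB_body_of_rung1At_of_drift_atSlopeCont_le (θ : Stage13HParams F N) (h : θ.Provisos₁₃SepCoPH F N) (w : WorldP)
    (hU : θ.ZhUnity F N ∧ θ.SlotsNondegenerate₁₃ F N) (hθ : θ.Admissible F N)
    (hR : ∃ (θ' : Stage13HParams F N) (h' : θ'.Provisos₁₃SepCoPH F N), θ'.Admissible F N ∧
      datumOfRecord₁₃SepCoPH F N θ h = datumOfRecord₁₃SepCoPH F N θ' h' ∧ w.C = (datumOfRecord₁₃SepCoPH F N θ h).C ∧ (0 < w.γ ∧ w.γ ≤ θ'.γ) ∧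
      w.L = (θ'.L : ℝ) ∧ ∀ P : B12.RunParams, w.up P = upOfRecord₅CS F N (θ'.toStage5₁₃CoPH F N) P)
    (hnodes : ∀ P : B12.RunParams, Nodes (leavesP w P))
    {d A γ₀ s : ℝ} (hγ₀ : 0 < γ₀)
    (hdrift : letI := θ.instVβ₁; letI := θ.instVβ₂; letI := θ.instιβ
      OneLoopDrift d A (beta0OfMerged (betaMerged F (mergedTermFamilyMatT F N (TcanOfRecord F N) (chiFixed29 F N θ.ν θ.ε₂₉) θ.εbg) θ.ρ8 θ.bV) θ.v₀))
    (hres : letI := θ.instVβ₁; letI := θ.instVβ₂; letI := θ.instιβ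
      AtSlopeCont
        (oneLoopSplit_betaOfMerged (betaMerged F (mergedTermFamilyMatT F N (TcanOfRecord F N) (chiFixed29 F N θ.ν θ.ε₂₉) θ.εbg) θ.ρ8 θ.bV)
          (beta0OfMerged (betaMerged F (mergedTermFamilyMatT F N (TcanOfRecord F N) (chiFixed29 F N θ.ν θ.ε₂₉) θ.εbg) θ.ρ8 θ.bV) θ.v₀) θ.γ)
        γ₀ s)
    (hsd : s ≤ d) (hceil : d + 2 * A + s ≤ w.βup) :
    (θ.ZhUnity F N ∧ θ.SlotsNondegenerate₁₃ F N) ∧ θ.Admissible F N ∧ B16.EndStatementBPrinted (datumOfRecord₁₃SepCoPH F N θ h).C ∧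
      ∃ γ₁ : ℝ, 0 < γ₁ ∧ ∀ γ : ℝ, 0 < γ → γ ≤ γ₁ → ∃ P : B12.RunParams, 1 ≤ P.K ∧ ((datumOfRecord₁₃SepCoPH F N θ h).C P).flow.InInterval γ P.K := by
  letI := θ.instVβ₁; letI := θ.instVβ₂; letI := θ.instιβ
  have hps : BetaPartialSumsLowerH (2 * A + 0) γ₀ (betaOfRecord₁₃ F N θ.toStage13Params) :=
    betaPartialSumsLowerH_of_drift_windowedLower _ hdrift (windowedLower_of_remainderConst _ (remainderConst_of_atSlopeCont hres)) hsd
  have hup : BetaUpperH (d + 2 * A + s) γ₀ (betaOfRecord₁₃ F N θ.toStage13Params) :=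
    betaUpperH_betaOfRecord₁₃_of_drift_atSlopeCont F N θ.toStage13Params hdrift hres
  exact stabilityB_body_of_rung1At_of_partialSumsH_of_ceiling θ h w hU hθ hR hnodes hγ₀ hps (fun k v hv => (hup k v hv).trans hceil)

end Drift

/-! ## §2. ★★★ The partial-sum floor FROM K2⁷'s TWO REGISTERED STUB BODIES READ AT θ: (D1)'s pinned residue and (D4)'s `AtSlopeCont` at (D1)'s slope — `s = d` by construction -/

section K2Pair

variable {F : T4Family} {N : ℕ} [NeZero N]

/-- **★★★ THE CRUX's CONSEQUENT AT θ FROM A RUNG-1 DATUM, K2⁷'s TWO STUB BODIES AT θ, AND THE CEILING.**  `hβ ∧ h1` = the body of K2⁷'s registered `stub_d1Residue13` READ AT `(F, θ)`: composite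
jets `Js` over a cube `Lc` whose second moments ARE the record's one-loop numbers, with cell pub-balaban-gaps' residue `Gaps.D1Residue.Residue Lc Js Nc 0 1` ([Balaban1987RG1] (2.12)–(2.13) p.268,
[Balaban1988RG2Cluster] Lemma 3); `hres` = the body of `stub_d4AtSlopeCont13` at the same data: `AtSlopeCont (split₁₃ θ) γ₀ (stepBal Nc Lc)`.  (D1) gives the drift of `β⁰_θ` with slope
`stepBal Nc Lc` and SOME defect `A` (`d1Drift_of_residue`); (D4) bounds the remainder by the SAME number on the box; so the slope condition of §1 is `le_rfl` and the partial sums of `β_θ` are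
`≥ −2A` — then the companion's `stabilityB_body_of_rung1At_of_partialSumsH_of_ceiling` with the ceiling letter `BetaUpperH w.βup γ₀ β_θ` (the rung-1 world's own; since `A` is hidden in (D1)'s ∃, the ceiling stays a SEPARATE displayed letter — N26 shows it is
`stepBal + 2A + stepBal` for that `A`).  CONDITIONAL on the three letters; K1⁷ ∕ K2⁷ NOT closed; nothing of Bałaban asserted.
[cite: Balaban1987RG1, Thm 2 p.259, (2.12)–(2.14) p.268, §1 (1.22) p.264; Balaban1988RG2Cluster, Lemma 3 (2.38) p.20; Balaban1989LargeFieldII, Thm 1 p.355; Balaban1988Convergent, (2.6) p.255 (bookkeeping)] -/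
theorem stabilityB_body_of_rung1At_of_k2Pair_of_ceiling (θ : Stage13HParams F N) (h : θ.Provisos₁₃SepCoPH F N) (w : WorldP)
    (hU : θ.ZhUnity F N ∧ θ.SlotsNondegenerate₁₃ F N) (hθ : θ.Admissible F N)
    (hR : ∃ (θ' : Stage13HParams F N) (h' : θ'.Provisos₁₃SepCoPH F N), θ'.Admissible F N ∧
      datumOfRecord₁₃SepCoPH F N θ h = datumOfRecord₁₃SepCoPH F N θ' h' ∧ w.C = (datumOfRecord₁₃SepCoPH F N θ h).C ∧ (0 < w.γ ∧ w.γ ≤ θ'.γ) ∧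
      w.L = (θ'.L : ℝ) ∧ ∀ P : B12.RunParams, w.up P = upOfRecord₅CS F N (θ'.toStage5₁₃CoPH F N) P)
    (hnodes : ∀ P : B12.RunParams, Nodes (leavesP w P))
    {Lc : ℕ} [NeZero Lc] (Js : ℕ → JetData 3 Lc) {Nc γ₀ : ℝ} (hγ₀ : 0 < γ₀)
    (hβ : letI := θ.instVβ₁; letI := θ.instVβ₂; letI := θ.instιβ
      ∀ j, beta0OfMerged (betaMerged F (mergedTermFamilyMatT F N (TcanOfRecord F N) (chiFixed29 F N θ.ν θ.ε₂₉) θ.εbg) θ.ρ8 θ.bV) θ.v₀ j =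
        B12Beta.secondMoment (TbalOf Lc Js j) 0 1)
    (h1 : Residue Lc Js Nc 0 1)
    (hres : letI := θ.instVβ₁; letI := θ.instVβ₂; letI := θ.instιβ
      AtSlopeCont
        (oneLoopSplit_betaOfMerged (betaMerged F (mergedTermFamilyMatT F N (TcanOfRecord F N) (chiFixed29 F N θ.ν θ.ε₂₉) θ.εbg) θ.ρ8 θ.bV)
          (beta0OfMerged (betaMerged F (mergedTermFamilyMatT F N (TcanOfRecord F N) (chiFixed29 F N θ.ν θ.ε₂₉) θ.εbg) θ.ρ8 θ.bV) θ.v₀) θ.γ)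
        γ₀ (B12Normalization.stepBal Nc Lc))
    (hhi : BetaUpperH w.βup γ₀ (betaOfRecord₁₃ F N θ.toStage13Params)) :
    (θ.ZhUnity F N ∧ θ.SlotsNondegenerate₁₃ F N) ∧ θ.Admissible F N ∧ B16.EndStatementBPrinted (datumOfRecord₁₃SepCoPH F N θ h).C ∧
      ∃ γ₁ : ℝ, 0 < γ₁ ∧ ∀ γ : ℝ, 0 < γ → γ ≤ γ₁ → ∃ P : B12.RunParams, 1 ≤ P.K ∧ ((datumOfRecord₁₃SepCoPH F N θ h).C P).flow.InInterval γ P.K := by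
  letI := θ.instVβ₁; letI := θ.instVβ₂; letI := θ.instιβ
  obtain ⟨A, hA⟩ := d1Drift_of_residue Js h1
  have hβfun : (beta0OfMerged (betaMerged F (mergedTermFamilyMatT F N (TcanOfRecord F N) (chiFixed29 F N θ.ν θ.ε₂₉) θ.εbg) θ.ρ8 θ.bV) θ.v₀) =
      fun j => B12Beta.secondMoment (TbalOf Lc Js j) 0 1 := funext hβ
  have hA' : OneLoopDrift (B12Normalization.stepBal Nc Lc) A
      (beta0OfMerged (betaMerged F (mergedTermFamilyMatT F N (TcanOfRecord F N) (chiFixed29 F N θ.ν θ.ε₂₉) θ.εbg) θ.ρ8 θ.bV) θ.v₀) := by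
    rw [hβfun]; exact hA
  exact stabilityB_body_of_rung1At_of_partialSumsH_of_ceiling θ h w hU hθ hR hnodes hγ₀
    (betaPartialSumsLowerH_of_drift_windowedLower _ hA' (windowedLower_of_remainderConst _ (remainderConst_of_atSlopeCont hres)) le_rfl) hhi

end K2Pair

/-! ## §3. ★★★★ `N = 2`: the ROUTE DECL BY NAME from K1⁷'s registered STUB 1, K2⁷'s TWO registered stub texts, and the ceiling letter at every rung-1 witness -/

section RegisteredK2

/-- **★★★★ K1⁷ BY NAME FROM K1⁷'s STUB 1, K2⁷'s STUBS 1 ∧ 2 (plan's `K2Skeleton13SepCoPH`: `D1AtRecord13`, `D4AtSlopeOfD1Record13` — texts VERBATIM), AND THE CEILING AT EVERY RUNG-1 WITNESS** — NO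
NODE-O letter (no sign, no AF floor): the β-side of K1⁷ is K2⁷'s.  `hceil` = «at every rung-1 witness `(θ, h, w)`: `∃ γ₁ > 0, BetaUpperH w.βup γ₁ (betaOfRecord₁₃ F 2 θ)`» ([Balaban1987RG1] §1
p.264 «uniformly bounded» read against the witness's ceiling; N26 computes the bound `stepBal + 2A + stepBal` from the same pair, the rung-1 world must carry a ceiling at least that large).
Windows merged by `min` (`FlowStepRuns.betaPartialSumsLowerH_mono`, `FlowStep.box_mono`).  CONDITIONAL on the four displayed hypotheses; K1⁷ ∕ K2⁷ NOT closed; nothing of Bałaban asserted;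
no count moved. [cite: Balaban1989LargeFieldII, Thm 1 p.355 + (0.1) pp.355–356 + p.391; Balaban1987RG1, Thm 2 p.259, (2.12)–(2.14) p.268, §1 (1.22) p.264; Balaban1988RG2Cluster, Lemma 3 (2.38) p.20; Balaban1988Convergent, (2.6) p.255 and Cor. 3 (2.50) p.264 (bookkeeping)] -/
theorem stabilityBAtRecordR13SepCoPH_of_stub1_of_k2Stubs_of_ceiling_at_witness
    (h₁ : ∀ F : T4Family, (∃ θ : Stage13HParams F 2, θ.Provisos₁₃SepCoPH F 2 ∧ (θ.ZhUnity F 2 ∧ θ.SlotsNondegenerate₁₃ F 2) ∧ θ.Admissible F 2) →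
      ∃ (θ : Stage13HParams F 2) (h : θ.Provisos₁₃SepCoPH F 2) (w : WorldP), (θ.ZhUnity F 2 ∧ θ.SlotsNondegenerate₁₃ F 2) ∧ θ.Admissible F 2 ∧
        (∃ (θ' : Stage13HParams F 2) (h' : θ'.Provisos₁₃SepCoPH F 2), θ'.Admissible F 2 ∧
          datumOfRecord₁₃SepCoPH F 2 θ h = datumOfRecord₁₃SepCoPH F 2 θ' h' ∧ w.C = (datumOfRecord₁₃SepCoPH F 2 θ h).C ∧ (0 < w.γ ∧ w.γ ≤ θ'.γ) ∧
          w.L = (θ'.L : ℝ) ∧ ∀ P : B12.RunParams, w.up P = upOfRecord₅CS F 2 (θ'.toStage5₁₃CoPH F 2) P) ∧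
        (∀ P : B12.RunParams, Nodes (leavesP w P)) ∧ PrintedUV3V 2 θ.L ∧
        ∃ lam : ResidW F 2, (∀ P : B12.RunParams, 1 ≤ P.K → lam.kSel P < P.K) ∧
          ∀ P : B12.RunParams, lam.kSel P < P.K → ((leavesP w P).rBasicStep ↔ B15Leaf (WOfRecord₁₃ F 2 θ.toStage13Params lam P)))
    (hD1 : ∀ (F : T4Family) (θ : Stage13HParams F 2) (_hP : θ.Provisos₁₃SepCoPH F 2), θ.Admissible F 2 →
      letI := θ.instVβ₁; letI := θ.instVβ₂; letI := θ.instιβ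
      ∃ (Lc : ℕ) (_ : NeZero Lc) (Js : ℕ → JetData 3 Lc) (Nc : ℝ),
        (∀ j, beta0OfMerged (betaMerged F (mergedTermFamilyMatT F 2 (TcanOfRecord F 2) (chiFixed29 F 2 θ.ν θ.ε₂₉) θ.εbg) θ.ρ8 θ.bV) θ.v₀ j =
            B12Beta.secondMoment (TbalOf Lc Js j) 0 1) ∧
        Residue Lc Js Nc 0 1)
    (hD4 : ∀ (F : T4Family) (θ : Stage13HParams F 2) (_hP : θ.Provisos₁₃SepCoPH F 2), θ.Admissible F 2 →
      letI := θ.instVβ₁; letI := θ.instVβ₂; letI := θ.instιβ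
      ∀ (Lc : ℕ) (_ : NeZero Lc) (Js : ℕ → JetData 3 Lc) (Nc : ℝ),
        (∀ j, beta0OfMerged (betaMerged F (mergedTermFamilyMatT F 2 (TcanOfRecord F 2) (chiFixed29 F 2 θ.ν θ.ε₂₉) θ.εbg) θ.ρ8 θ.bV) θ.v₀ j =
            B12Beta.secondMoment (TbalOf Lc Js j) 0 1) →
        Residue Lc Js Nc 0 1 →
        ∃ γ₀ : ℝ, 0 < γ₀ ∧ γ₀ ≤ θ.γ ∧
          AtSlopeCont
            (oneLoopSplit_betaOfMerged (betaMerged F (mergedTermFamilyMatT F 2 (TcanOfRecord F 2) (chiFixed29 F 2 θ.ν θ.ε₂₉) θ.εbg) θ.ρ8 θ.bV)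
              (beta0OfMerged (betaMerged F (mergedTermFamilyMatT F 2 (TcanOfRecord F 2) (chiFixed29 F 2 θ.ν θ.ε₂₉) θ.εbg) θ.ρ8 θ.bV) θ.v₀) θ.γ)
            γ₀ (B12Normalization.stepBal Nc Lc))
    (hceil : ∀ (F : T4Family) (θ : Stage13HParams F 2) (h : θ.Provisos₁₃SepCoPH F 2) (w : WorldP),
      (θ.ZhUnity F 2 ∧ θ.SlotsNondegenerate₁₃ F 2) → θ.Admissible F 2 →
      (∃ (θ' : Stage13HParams F 2) (h' : θ'.Provisos₁₃SepCoPH F 2), θ'.Admissible F 2 ∧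
        datumOfRecord₁₃SepCoPH F 2 θ h = datumOfRecord₁₃SepCoPH F 2 θ' h' ∧ w.C = (datumOfRecord₁₃SepCoPH F 2 θ h).C ∧ (0 < w.γ ∧ w.γ ≤ θ'.γ) ∧
        w.L = (θ'.L : ℝ) ∧ ∀ P : B12.RunParams, w.up P = upOfRecord₅CS F 2 (θ'.toStage5₁₃CoPH F 2) P) →
      (∀ P : B12.RunParams, Nodes (leavesP w P)) → PrintedUV3V 2 θ.L →
      (∃ lam : ResidW F 2, (∀ P : B12.RunParams, 1 ≤ P.K → lam.kSel P < P.K) ∧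
        ∀ P : B12.RunParams, lam.kSel P < P.K → ((leavesP w P).rBasicStep ↔ B15Leaf (WOfRecord₁₃ F 2 θ.toStage13Params lam P))) →
      ∃ γ₁ : ℝ, 0 < γ₁ ∧ BetaUpperH w.βup γ₁ (betaOfRecord₁₃ F 2 θ.toStage13Params)) :
    Summit.QuantumFields.YangMills.Theses.BalabanUVNodes.StabilityBAtRecordR13SepCoPH := by
  intro F hinh
  obtain ⟨θ, h, w, hU, hθ, hR, hnodes, h08, hlam⟩ := h₁ F hinh
  letI := θ.instVβ₁; letI := θ.instVβ₂; letI := θ.instιβ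
  obtain ⟨Lc, hLc, Js, Nc, hβ, h1⟩ := hD1 F θ h hθ
  obtain ⟨γ₀, hγ₀, -, hres⟩ := hD4 F θ h hθ Lc hLc Js Nc hβ h1
  obtain ⟨γ₁, hγ₁, hhi⟩ := hceil F θ h w hU hθ hR hnodes h08 hlam
  obtain ⟨A, hA⟩ := d1Drift_of_residue Js h1
  have hβfun : (beta0OfMerged (betaMerged F (mergedTermFamilyMatT F 2 (TcanOfRecord F 2) (chiFixed29 F 2 θ.ν θ.ε₂₉) θ.εbg) θ.ρ8 θ.bV) θ.v₀) =
      fun j => B12Beta.secondMoment (TbalOf Lc Js j) 0 1 := funext hβ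
  have hA' : OneLoopDrift (B12Normalization.stepBal Nc Lc) A
      (beta0OfMerged (betaMerged F (mergedTermFamilyMatT F 2 (TcanOfRecord F 2) (chiFixed29 F 2 θ.ν θ.ε₂₉) θ.εbg) θ.ρ8 θ.bV) θ.v₀) := by
    rw [hβfun]; exact hA
  have hps : BetaPartialSumsLowerH (2 * A + 0) γ₀ (betaOfRecord₁₃ F 2 θ.toStage13Params) :=
    betaPartialSumsLowerH_of_drift_windowedLower _ hA' (windowedLower_of_remainderConst _ (remainderConst_of_atSlopeCont hres)) le_rfl
  exact ⟨θ, h, stabilityB_body_of_rung1At_of_partialSumsH_of_ceiling θ h w hU hθ hR hnodes (lt_min hγ₀ hγ₁)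
    (betaPartialSumsLowerH_mono (min_le_left _ _) hps) (fun k v hv => hhi k v (box_mono (min_le_right _ _) k hv))⟩

end RegisteredK2

end Summit.QuantumFields.YangMills.BalabanUVNodes.K1EndOfNodes13PWSOfK2Pair

end
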